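import Mathlib
import Summits.ValiantsHypothesis.ValiantsHypothesis.Theorems.MonotoneRestorationOrbitRestorationQPValueOrbitClosure
import Summits.ValiantsHypothesis.ValiantsHypothesis.Theorems.MonotoneRestorationOrbitRestorationQPValueOrbitRestoration
import Summits.ValiantsHypothesis.ValiantsHypothesis.Theorems.MonotoneRestorationOrbitRestorationQPValueDerivationSubst
import Summits.ValiantsHypothesis.ValiantsHypothesis.Theorems.MonotoneRestorationOrbitRestorationQPRowColumnWreath
import HarnessLib

/-!
# Orbit restorability is transpose-invariant; the column wreath stratum (ORBIT currency)

Route MonotoneRestoration, crux `OrbitRestorationQP` (stmt-ValiantsHypothesis-18293), line `depth-three-rung`, registered stub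
`stub_sigmaPiSigmaValue` (A_∞).  Namespace `Summit.ValiantsHypothesis.ValiantsHypothesis.Theorems.Transpose`.  Definition-free.

The diagonal action of `Sym_n` on the `n × n` matrix of variables commutes with transposition `x_{ij} ↦ x_{ji}`, so every
statement of the line in ORBIT currency has a transposed twin.  In value-derivation vocabulary (`…ValueDerivation.lean`,
`…ValueOrbitClosure.lean`, `…ValueOrbitRestoration.lean`) the transport costs nothing but the flat `+3` of the
derivation-to-circuit conversion:

* `exists_valueDerivation_perm` — a value derivation is transported along ANY permutation `e` of the variables (values
  exactly `ren e '' S`, steps `StepData.map e`);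
* `ren_prodComm`, `ren_swap_comm` — transposition is `ren` of the permutation `Equiv.prodComm`, and commutes with the diagonal
  action;
* `qpOrbitRestorable_transpose`, `qpOrbitRestorable_of_transpose` — **`QPOrbitRestorable c n p → QPOrbitRestorable (c+3) n pᵀ`**
  and back;
* `qpOrbitRestorable_of_colwise_symmetric` — **THE COLUMN WREATH STRATUM**: a matrix-symmetric polynomial invariant under
  permuting the entries inside each column independently is `QPOrbitRestorable 15 n` (transpose of
  `RowColumnWreath.qpOrbitRestorable_of_rowwise_symmetric`).

Calibration: bookkeeping (transport of structure); closes item 2 of the repair census ROWCOL-LANE-g7.  Nothing here bears on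
VP ≠ VNP. [folklore] [cite: DawarWilsenach2025, §3.3]
-/

noncomputable section

open scoped Classical

-- `Summit.ValiantsHypothesis.ValiantsHypothesis.…` is the tree's single-conjunct layout (Sub = Summit).
set_option linter.dupNamespace false

namespace Summit.ValiantsHypothesis.ValiantsHypothesis.Theorems

namespace Transpose

open MvPolynomial Equiv Literature.Computability.AlgebraicComplexity OrbitRestorationQPDepthThreeRung

universe u v

/-! ### Transport of a value derivation along a permutation of the variables -/

/-- **A value derivation transported along a permutation of the variables** is a value derivation: values `ren e '' S`,
steps `StepData.map e`, ranks pulled back along `e⁻¹`. [folklore] -/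
theorem exists_valueDerivation_perm {K : Type u} {X : Type v} [Field K] (e : Equiv.Perm X) (𝒟 : ValueDerivation K X) :
    ∃ 𝒟' : ValueDerivation K X, (∀ q ∈ 𝒟.S, ren e q ∈ 𝒟'.S) ∧ ∀ q' ∈ 𝒟'.S, ∃ q ∈ 𝒟.S, ren e q = q' := by
  refine ⟨⟨𝒟.S.image (ren e), fun q => 𝒟.rank (ren e⁻¹ q), fun q' hq' => ?_⟩,
    fun q hq => Finset.mem_image_of_mem _ hq, fun q' hq' => Finset.mem_image.1 hq'⟩
  obtain ⟨q, hq, rfl⟩ := Finset.mem_image.1 hq'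
  obtain ⟨d, hd⟩ := 𝒟.step q hq
  refine ⟨d.map e, ⟨by rw [StepData.value_map, hd.value_eq], fun u' hu' => ?_⟩⟩
  rw [StepData.args_map, Multiset.mem_map] at hu'
  obtain ⟨u, hu, rfl⟩ := hu'
  obtain ⟨huS, hlt⟩ := hd.args_lt u hu
  refine ⟨Finset.mem_image_of_mem _ huS, ?_⟩
  simp only [ren_inv_ren]
  exact hlt

variable {n : ℕ}

/-- Transposition is the renaming by the permutation `Equiv.prodComm` of the variable matrix. [folklore] -/
theorem ren_prodComm (q : MvPolynomial (Fin n × Fin n) ℂ) :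
    ren (Equiv.prodComm (Fin n) (Fin n)) q = rename Prod.swap q := by
  unfold ren
  congr 1

/-- Transposition commutes with the diagonal action of `Sym_n`. [folklore] -/
theorem ren_swap_comm (σ : Perm (Fin n)) (q : MvPolynomial (Fin n × Fin n) ℂ) :
    ren σ (rename Prod.swap q) = rename Prod.swap (ren σ q) := by
  have h : ((fun x : Fin n × Fin n => σ • x) ∘ Prod.swap) = Prod.swap ∘ fun x : Fin n × Fin n => σ • x :=
    funext fun ⟨a, b⟩ => rfl
  unfold ren
  rw [rename_rename, rename_rename, h]

/-! ### Transpose invariance of `QPOrbitRestorable` -/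

/-- **`QPOrbitRestorable` is transpose-invariant (flat cost `+3`)**: if `p` has a square-symmetric circuit of orbit size
`≤ 2^((log₂ n + c)^c)`, then `pᵀ = p(x_{ji})` has one of orbit size `≤ 2^((log₂ n + c + 3)^(c+3))`. [folklore] -/
theorem qpOrbitRestorable_transpose {c : ℕ} {p : MvPolynomial (Fin n × Fin n) ℂ} (hp : QPOrbitRestorable c n p) :
    QPOrbitRestorable (c + 3) n (rename Prod.swap p) := by
  obtain ⟨hfix, 𝒟, hpS, hS⟩ := ValueOrbit.exists_valueDerivation_of_qpOrbitRestorable hp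
  obtain ⟨𝒟', hto, hfrom⟩ := exists_valueDerivation_perm (Equiv.prodComm (Fin n) (Fin n)) 𝒟
  have hmem : rename Prod.swap p ∈ 𝒟'.S := by
    rw [← ren_prodComm]
    exact hto p hpS
  have hfix' : ∀ σ : Perm (Fin n), ren σ (rename Prod.swap p) = rename Prod.swap p := fun σ => by
    rw [ren_swap_comm, hfix σ]
  have hS' : ∀ q ∈ 𝒟'.S, (Set.range fun σ : Perm (Fin n) => ren σ q).ncard ≤ 2 ^ ((Nat.log 2 n + c) ^ c) := by
    intro q' hq'
    obtain ⟨q, hq, rfl⟩ := hfrom q' hq'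
    rw [ren_prodComm]
    exact (ValueDerivation.ncard_orbit_map_le (Γ := Perm (Fin n))
      (rename Prod.swap : MvPolynomial (Fin n × Fin n) ℂ →ₐ[ℂ] MvPolynomial (Fin n × Fin n) ℂ)
      (fun σ r => ren_swap_comm σ r) q).trans (hS q hq)
  obtain ⟨G, inst, C, hC, hev, horb⟩ := ValueOrbit.qpOrbit_of_valueDerivation 𝒟' hmem hfix' hS'
  exact ⟨G, inst, C, hC, hev, horb⟩

/-- … and back: restoring the transpose restores `p`. [folklore] -/
theorem qpOrbitRestorable_of_transpose {c : ℕ} {p : MvPolynomial (Fin n × Fin n) ℂ}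
    (hp : QPOrbitRestorable c n (rename Prod.swap p)) : QPOrbitRestorable (c + 3) n p := by
  have h := qpOrbitRestorable_transpose hp
  rwa [rename_rename, Prod.swap_swap_eq, rename_id, AlgHom.id_apply] at h

/-! ### The column wreath stratum -/

/-- The transpose of a matrix-symmetric polynomial is matrix-symmetric. [folklore] -/
theorem matrixSymmetric_transpose {p : MvPolynomial (Fin n × Fin n) ℂ}
    (hsym : ∀ σ τ : Perm (Fin n), rename (fun q : Fin n × Fin n => (σ q.1, τ q.2)) p = p) (σ τ : Perm (Fin n)) :
    rename (fun q : Fin n × Fin n => (σ q.1, τ q.2)) (rename Prod.swap p) = rename Prod.swap p := by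
  rw [rename_rename,
    show ((fun q : Fin n × Fin n => (σ q.1, τ q.2)) ∘ Prod.swap) = Prod.swap ∘ fun q : Fin n × Fin n => (τ q.1, σ q.2) from
      funext fun q => rfl,
    ← rename_rename, hsym τ σ]

/-- Within-column symmetry of `p` is within-row symmetry of `pᵀ`. [folklore] -/
theorem rowwise_symmetric_transpose {p : MvPolynomial (Fin n × Fin n) ℂ}
    (hcol : ∀ (j : Fin n) (τ : Perm (Fin n)),
      rename (fun q : Fin n × Fin n => if q.2 = j then (τ q.1, q.2) else q) p = p)
    (i : Fin n) (τ : Perm (Fin n)) :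
    rename (fun q : Fin n × Fin n => if q.1 = i then (q.1, τ q.2) else q) (rename Prod.swap p) = rename Prod.swap p := by
  have hfun : ((fun q : Fin n × Fin n => if q.1 = i then (q.1, τ q.2) else q) ∘ Prod.swap) =
      Prod.swap ∘ fun q : Fin n × Fin n => if q.2 = i then (τ q.1, q.2) else q := by
    funext q
    obtain ⟨a, b⟩ := q
    simp only [Function.comp_apply, Prod.swap_prod_mk]
    split_ifs <;> rfl
  rw [rename_rename, hfun, ← rename_rename, hcol i τ]

/-- **THE COLUMN WREATH STRATUM.**  A matrix-symmetric polynomial on the `n × n` matrix invariant under permuting the entries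
inside each column independently is `QPOrbitRestorable 15 n`. [folklore] -/
theorem qpOrbitRestorable_of_colwise_symmetric {p : MvPolynomial (Fin n × Fin n) ℂ}
    (hsym : ∀ σ τ : Perm (Fin n), rename (fun q : Fin n × Fin n => (σ q.1, τ q.2)) p = p)
    (hcol : ∀ (j : Fin n) (τ : Perm (Fin n)),
      rename (fun q : Fin n × Fin n => if q.2 = j then (τ q.1, q.2) else q) p = p) :
    QPOrbitRestorable 15 n p :=
  qpOrbitRestorable_of_transpose
    (RowColumnWreath.qpOrbitRestorable_of_rowwise_symmetric (matrixSymmetric_transpose hsym) (rowwise_symmetric_transpose hcol))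

/-- The column wreath stratum in the shape of the stub `stub_sigmaPiSigmaValue` (absolute constant `c = 15`). [folklore] -/
theorem restoration_of_colwise_symmetric_family (f : (n : ℕ) → MvPolynomial (Fin n × Fin n) ℂ) (hsym : IsMatrixSymmetric f)
    (hcol : ∀ (n : ℕ) (j : Fin n) (τ : Perm (Fin n)),
      rename (fun q : Fin n × Fin n => if q.2 = j then (τ q.1, q.2) else q) (f n) = f n) :
    ∃ c : ℕ, ∀ n : ℕ, QPOrbitRestorable c n (f n) :=
  ⟨15, fun n => qpOrbitRestorable_of_colwise_symmetric (hsym n) (hcol n)⟩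

end Transpose

end Summit.ValiantsHypothesis.ValiantsHypothesis.Theorems

end
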